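import Summits.BirchSwinnertonDyer.Rank1Residual.X2.CongruenceTransferCovered
import HarnessLib

/-!
# Class X2: ROUTE G WITH A COVERED PARTNER — the NON-SPLIT forms (where covered relatives live)
# (cell `b2b-bsdres`, unit `b2b-bsdres-eisenstein-p2`, gen 14; companion of
# `X2/CongruenceTransferCovered.lean`)

HONEST FRAMING (run/shared/lean/b2b/bsd-rank1-residual/, verbatim in every file): the goal of the
cell is to DELETE the COMBINATION-SHAPED residual classes of the Birch–Swinnerton-Dyer formula for
ALL analytic-rank `≤ 1` elliptic curves over `ℚ` — "full BSD formula for every rank `≤ 1` curve in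
class `C`" assembled STRICTLY from published theorems — so that the rank-`≤ 1` remainder becomes
exactly the CONSTRUCTION-SHAPED classes, which are TYPED (missing-input `Prop`s), NOT attempted.
This is not "finishing BSD". Research route; NO CLAIM BEYOND STATED CLASSES; nothing here changes a
label; X2b and X2c stay CONSTRUCTION-SHAPED (route G is a per-pair CERTIFICATE route). Theorems only
(no definition, no named fact, nothing asserted).

At a NON-SPLIT multiplicative Eisenstein prime `p` of `E₀` a good congruent relative `E₀'`
(`E₀'[p] ≅ E₀[p]`) is ordinary and NON-ANOMALOUS (`a_p(E₀') ≡ −1 (mod p)`), so its Mazur main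
conjecture is Castella–Grossi–Skinner 2025 Thm. A; and the trivial-zero shift vanishes
(`e_p(E₀) = 0`). The theorems of the companion file then read: ONE integer inequality
`λ_an(E₀) ≤ λ_an(E₀') + Σ_{v∈Σ₀}(δ_{E₀'}^{(v)} − δ_{E₀}^{(v)})` between two-engine census values +
the congruence + the local data ⇒ Mazur's main conjecture at `(E₀, p)` (both ranks; X2b's typed
input; X2c's cyclotomic main conjecture) and `BSD(E₀, p)` at `r_an = 0` — from PUBLISHED statements
(CGS 2025 Thm. A; Wuthrich 2014 Thm. 16; Tate's uniformisation; Greenberg–Vatsal 2000 §1 (5)–(7),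
§2 Prop. 2.5, pp. 15, 26; Stein–Wuthrich 2013 Thm. 6.1; Greenberg–Stevens; GZK; modularity) and
per-pair certificates only. Census (gen 14, HOME/b2b-bsdres-eisenstein-p2/covered/): 224 of the 254
non-split X2 pairs at `p = 3`, `N < 2·10⁴`, have a covered relative of conductor `< 2·10⁴`.

References: [CastellaGrossiSkinner2025] Thm. A; [GreenbergVatsal2000] Thm. (1.4), §1–§2;
[Wuthrich2014] Thm. 16; [SteinWuthrich2013] Thm. 6.1; HOME/b2b-bsdres-eisenstein-p2/X2-GAP.md §19.
-/

set_option autoImplicit false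

noncomputable section

open scoped Classical MatrixGroups ModularForm

open PowerSeries CongruenceSubgroup WeierstrassCurve NumberField IsDedekindDomain
  Literature.NumberTheory.EllipticCurves
  Literature.NumberTheory.EllipticCurves.ModularForms
  Literature.NumberTheory.EllipticCurves.Rank1Residual
  Literature.NumberTheory.EllipticCurves.Rank1Residual.Typed
  Literature.NumberTheory.EllipticCurves.Wuthrich2014
  Literature.NumberTheory.EllipticCurves.SteinWuthrich2013
  Literature.NumberTheory.EllipticCurves.Greenberg1999
  Literature.NumberTheory.EllipticCurves.GreenbergVatsal2000
  Literature.NumberTheory.EllipticCurves.CastellaGrossiSkinner2025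
  Summit.BirchSwinnertonDyer.BirchSwinnertonDyer.Theorems.Rank1ResidualX1Defs
  Summit.BirchSwinnertonDyer.Rank1Residual.X1.MuLambda
  Summit.BirchSwinnertonDyer.Rank1Residual.X1.MuPart
  Summit.BirchSwinnertonDyer.Rank1Residual.X1.ParitySqueeze
  Summit.BirchSwinnertonDyer.Rank1Residual.X1.TamagawaSqueeze
  Summit.BirchSwinnertonDyer.Rank1Residual.X1.CongruenceTransfer
  Summit.BirchSwinnertonDyer.Rank1Residual.X2.CongruentLambdaShiftMultiplicative

namespace Summit.BirchSwinnertonDyer.Rank1Residual.X2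

/-! ## Reducibility travels along the congruence -/

/-- **`E₀[p]` reducible and `E₀[p] ≅ E₀'[p]` (as `Γ_ℚ`-modules) ⇒ `E₀'[p]` reducible**: the
relative of an Eisenstein pair is Eisenstein, so the `hred'` binder of the covered-partner theorems
is discharged by the congruence itself (tree: `GreenbergVatsal2000.hasIrreducibleModPGaloisRep_of_torsionIso`).
[cite: GreenbergVatsal2000, Thm. (1.4) (hypothesis "E₁[p] ≅ E₂[p]")] -/
theorem not_hasIrreducibleModPGaloisRep_of_torsionIso {W W' : WeierstrassCurve ℚ} {p : ℕ}
    (hiso : TorsionIso W W' p) (hred : ¬ W.HasIrreducibleModPGaloisRep p) :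
    ¬ W'.HasIrreducibleModPGaloisRep p := by
  obtain ⟨e, he⟩ := hiso.symm
  exact fun h ↦ hred (hasIrreducibleModPGaloisRep_of_torsionIso e he h)

/-! ## The NON-SPLIT forms: `e_p(E₀) = 0`, one inequality -/

section NonSplit

variable {W W' : WeierstrassCurve ℚ} [W.IsElliptic] [W.IsGloballyMinimal]
  [W'.IsElliptic] [W'.IsGloballyMinimal] {p : ℕ} [Fact p.Prime]
  (S₀ : Finset (HeightOneSpectrum (𝓞 ℚ)))

/-- **NON-SPLIT X2 pair, COVERED relative, shift DERIVED ⇒ Mazur's main conjecture at the pair**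
(both ranks): `(E₀, p)` non-split multiplicative, `E₀[p]` reducible, `p ≠ 2`, `μ_an(E₀) = 0`,
`λ_an(E₀) = n`; `(E₀', p)` good, `a_p ≢ 1 (mod p)` (`E₀'[p]` is reducible by the congruence,
`not_hasIrreducibleModPGaloisRep_of_torsionIso`), `μ_an = 0`, `λ_an = n'`;
`E₀[p] ≅ E₀'[p]`; `Σ₀ ∌ p` ⊇ bad primes of both; and the ONE integer inequality
`n ≤ n' + Σ_{v∈Σ₀}(δ_{E₀'}^{(v)} − δ_{E₀}^{(v)})` (then `=`). Inputs beyond certificates: CGS 2025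
Thm. A, Wuthrich 2014 Thm. 16 (both forms), modularity, Tate's uniformisation (A40/A41) and the
Greenberg–Vatsal §1–§2 statements A111/A115/A116 + GV (5)–(7) at `p ‖ N`, Prop. 2.5, p. 15 — ALL
PUBLISHED. [cite: CastellaGrossiSkinner2025, Theorem A]
[cite: GreenbergVatsal2000, Thm. (1.4), §1 (5)–(7), pp. 14–15, §2 pp. 20–27]
[cite: Wuthrich2014, Thm. 16 (p. 397)] -/
theorem mazurMainConjectureAt_of_coveredRelative_of_not_split
    (hA : thmA_charIdeal_eq_padicLFunction)
    (hWu : thm16_charIdeal_dvd_multiplicative_of_reducible)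
    (hW16 : Wuthrich2014.charIdeal_dvd_padicLFunction)
    (hpar : nonempty_modularParametrizationData)
    (hT : Silverman1994_thmV53_corV54_tateUniformisation.{0})
    (hT' : Silverman1994_thmV53_tateUniformisation.{0})
    (hAm : lambda_nonPrimitive_eq_add_sum_delta_multiplicative)
    (hBm : datumSelmer_divisible_of_finite_torsionBy) (hF : datumStrictSelmer_lt_datumSelmer_of_split)
    (hGV : imKummer_ge_greenbergCondition_at_p) (hA7 : lambda_nonPrimitive_eq_add_sum_delta)
    (hB : divisible_nonPrimitiveSelmerInfty_of_mu_eq_zero) (hp2 : p ≠ 2)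
    (hmult : W.HasMultiplicativeReductionAtPrime p)
    (hns : ¬ W.HasSplitMultiplicativeReductionAtPrime p) (hred : ¬ W.HasIrreducibleModPGaloisRep p)
    {n : ℕ} (hμ0 : AnalyticMuLE W p 0) (hlam : AnalyticLambdaEq W p n)
    (hgood' : W'.HasGoodReductionAtPrime p)
    (hna' : ¬ (p : ℤ) ∣ W'.frobeniusTrace p - 1) {n' : ℕ}
    (hμ0' : X1.MuPart.AnalyticMuLE W' p 0) (hlam' : X1.ParitySqueeze.AnalyticLambdaEq W' p n')
    (hS₀ : ∀ v ∈ S₀, ((p : ℕ) : 𝓞 ℚ) ∉ v.asIdeal)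
    (hS : ∀ v : HeightOneSpectrum (𝓞 ℚ), v ∉ S₀ → ((p : ℕ) : 𝓞 ℚ) ∉ v.asIdeal →
      W.HasGoodReductionAt v)
    (hS' : ∀ v : HeightOneSpectrum (𝓞 ℚ), v ∉ S₀ → ((p : ℕ) : 𝓞 ℚ) ∉ v.asIdeal →
      W'.HasGoodReductionAt v)
    (hiso : TorsionIso W W' p) {k : ℕ}
    (hk : (k : ℤ) = n' + ∑ v ∈ S₀, ((delta W' p v : ℤ) - (delta W p v : ℤ))) (hn : n ≤ k) :
    X2.MazurMainConjectureAt W p :=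
  mazurMainConjectureAt_of_coveredRelative_of_facts S₀ hA hWu hW16 hpar hT hT' hAm hBm hF hGV hA7 hB hp2
    hmult hred hμ0 hlam hgood' (not_hasIrreducibleModPGaloisRep_of_torsionIso hiso hred) hna' hμ0'
    hlam' hS₀ hS hS' hiso (by rw [if_neg hns, sub_zero]; exact hk) (fun _ ↦ hn)
    (fun h ↦ absurd h hns)

/-- **NON-SPLIT X2b pair (rank `0`), COVERED relative, shift DERIVED ⇒ `BSD(E₀, p)`.** As above with
`r_an(E₀) = 0`; the last step is gen 1's `bsdp_of_mazurMainConjectureAt_of_analyticRank_eq_zero`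
(Stein–Wuthrich Thm. 6.1, Greenberg–Stevens, GZK, modularity).
[cite: CastellaGrossiSkinner2025, Theorem A]
[cite: GreenbergVatsal2000, Thm. (1.4), §1 (5)–(7), pp. 14–15, §2 pp. 20–27]
[cite: Wuthrich2014, Thm. 16 (p. 397)] [cite: SteinWuthrich2013, Thm. 6.1 (p. 20)] -/
theorem bsdp_of_coveredRelative_rankZero_of_not_split (hA : thmA_charIdeal_eq_padicLFunction)
    (hWu : thm16_charIdeal_dvd_multiplicative_of_reducible)
    (hW16 : Wuthrich2014.charIdeal_dvd_padicLFunction)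
    (hJs : thm61_splitMultiplicative) (hJn : thm61_nonsplitMultiplicative)
    (hHs : exists_isSplitMultCanonical) (hHn : exists_isMultCanonical)
    (hGZK : rank_eq_analyticRank_of_analyticRank_le_one) (hmod : hasEntireLFunction_rat)
    (hpar : nonempty_modularParametrizationData)
    (hT : Silverman1994_thmV53_corV54_tateUniformisation.{0})
    (hT' : Silverman1994_thmV53_tateUniformisation.{0})
    (hAm : lambda_nonPrimitive_eq_add_sum_delta_multiplicative)
    (hBm : datumSelmer_divisible_of_finite_torsionBy) (hF : datumStrictSelmer_lt_datumSelmer_of_split)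
    (hGV : imKummer_ge_greenbergCondition_at_p) (hA7 : lambda_nonPrimitive_eq_add_sum_delta)
    (hB : divisible_nonPrimitiveSelmerInfty_of_mu_eq_zero)
    (W W' : WeierstrassCurve ℚ) [W.IsElliptic] [W.IsGloballyMinimal] [W'.IsElliptic]
    [W'.IsGloballyMinimal] (p : ℕ) [Fact p.Prime] (hGS : greenberg_stevens (W := W) (p := p))
    (hp2 : p ≠ 2) (hmult : W.HasMultiplicativeReductionAtPrime p)
    (hns : ¬ W.HasSplitMultiplicativeReductionAtPrime p)
    (hred : ¬ W.HasIrreducibleModPGaloisRep p) (hr : W.analyticRank = 0) {n : ℕ}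
    (hμ0 : AnalyticMuLE W p 0) (hlam : AnalyticLambdaEq W p n)
    (hgood' : W'.HasGoodReductionAtPrime p)
    (hna' : ¬ (p : ℤ) ∣ W'.frobeniusTrace p - 1) {n' : ℕ}
    (hμ0' : X1.MuPart.AnalyticMuLE W' p 0) (hlam' : X1.ParitySqueeze.AnalyticLambdaEq W' p n')
    (hS₀ : ∀ v ∈ S₀, ((p : ℕ) : 𝓞 ℚ) ∉ v.asIdeal)
    (hS : ∀ v : HeightOneSpectrum (𝓞 ℚ), v ∉ S₀ → ((p : ℕ) : 𝓞 ℚ) ∉ v.asIdeal →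
      W.HasGoodReductionAt v)
    (hS' : ∀ v : HeightOneSpectrum (𝓞 ℚ), v ∉ S₀ → ((p : ℕ) : 𝓞 ℚ) ∉ v.asIdeal →
      W'.HasGoodReductionAt v)
    (hiso : TorsionIso W W' p) {k : ℕ}
    (hk : (k : ℤ) = n' + ∑ v ∈ S₀, ((delta W' p v : ℤ) - (delta W p v : ℤ))) (hn : n ≤ k) :
    BSDp W p :=
  bsdp_of_mazurMainConjectureAt_of_analyticRank_eq_zero hJs hJn hHs hHn hGZK hmod hpar W p hGS hp2
    hmult hr (mazurMainConjectureAt_of_coveredRelative_of_not_split S₀ hA hWu hW16 hpar hT hT' hAm hBm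
      hF hGV hA7 hB hp2 hmult hns hred hμ0 hlam hgood' hna' hμ0' hlam' hS₀ hS hS' hiso hk hn)

/-- **NON-SPLIT X2b pair: its TYPED INPUT `MissingInputB W p` from a COVERED relative** (shift
derived) — bookkeeping form for the Partition (`MissingInputB = X2.MazurMainConjectureAt`).
[cite: CastellaGrossiSkinner2025, Theorem A] [cite: GreenbergVatsal2000, Thm. (1.4), §2 pp. 26–27]
[cite: Wuthrich2014, Thm. 16 (p. 397)] -/
theorem missingInputB_of_coveredRelative_of_not_split (hA : thmA_charIdeal_eq_padicLFunction)
    (hWu : thm16_charIdeal_dvd_multiplicative_of_reducible)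
    (hW16 : Wuthrich2014.charIdeal_dvd_padicLFunction)
    (hpar : nonempty_modularParametrizationData)
    (hT : Silverman1994_thmV53_corV54_tateUniformisation.{0})
    (hT' : Silverman1994_thmV53_tateUniformisation.{0})
    (hAm : lambda_nonPrimitive_eq_add_sum_delta_multiplicative)
    (hBm : datumSelmer_divisible_of_finite_torsionBy) (hF : datumStrictSelmer_lt_datumSelmer_of_split)
    (hGV : imKummer_ge_greenbergCondition_at_p) (hA7 : lambda_nonPrimitive_eq_add_sum_delta)
    (hB : divisible_nonPrimitiveSelmerInfty_of_mu_eq_zero)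
    (W W' : WeierstrassCurve ℚ) [W.IsElliptic] [W.IsGloballyMinimal] [W'.IsElliptic]
    [W'.IsGloballyMinimal] (p : ℕ) [Fact p.Prime] (hc : CellB W p)
    (hns : ¬ W.HasSplitMultiplicativeReductionAtPrime p) {n : ℕ}
    (hμ0 : AnalyticMuLE W p 0) (hlam : AnalyticLambdaEq W p n)
    (hgood' : W'.HasGoodReductionAtPrime p)
    (hna' : ¬ (p : ℤ) ∣ W'.frobeniusTrace p - 1) {n' : ℕ}
    (hμ0' : X1.MuPart.AnalyticMuLE W' p 0) (hlam' : X1.ParitySqueeze.AnalyticLambdaEq W' p n')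
    (hS₀ : ∀ v ∈ S₀, ((p : ℕ) : 𝓞 ℚ) ∉ v.asIdeal)
    (hS : ∀ v : HeightOneSpectrum (𝓞 ℚ), v ∉ S₀ → ((p : ℕ) : 𝓞 ℚ) ∉ v.asIdeal →
      W.HasGoodReductionAt v)
    (hS' : ∀ v : HeightOneSpectrum (𝓞 ℚ), v ∉ S₀ → ((p : ℕ) : 𝓞 ℚ) ∉ v.asIdeal →
      W'.HasGoodReductionAt v)
    (hiso : TorsionIso W W' p) {k : ℕ}
    (hk : (k : ℤ) = n' + ∑ v ∈ S₀, ((delta W' p v : ℤ) - (delta W p v : ℤ))) (hn : n ≤ k) :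
    MissingInputB W p :=
  mazurMainConjectureAt_of_coveredRelative_of_not_split S₀ hA hWu hW16 hpar hT hT' hAm hBm hF hGV hA7
    hB hc.2.1.1 hc.2.1.2.2 hns hc.2.1.2.1 hμ0 hlam hgood' hna' hμ0' hlam' hS₀ hS hS' hiso hk hn

end NonSplit

end Summit.BirchSwinnertonDyer.Rank1Residual.X2

end
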